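import Literature.AlgebraicGeometry.Resolution.WeightedCentreClassLinearPin
import HarnessLib

/-!
# THEOREM RZ's two unpinning cases (instrument for engine 1's `W(f)` toy model, NOT a resolution theorem)

Engine 1 of the RESOLUTION OBSERVATORY toy model `W(f)` (cell notes RE-DERIVATION-eng1-g41 §3.7.4 THEOREM RZ, the paragraph after
`(E_p)`: "`∂_θ ḡ = 0` for all `θ` in `Θ := span_k{θ_γ} ≠ 0`.  Case `C* =` an `I`-class … `∂_{e₁}ḡ = 0` says every monomial of `ḡ` has
`ε_{u,1}`-exponent `≡ 0 (mod p)` … its `ε_{u,1}`-exponent lies in `[1, p−1]` … So `ε_{u,1}` has no pin.  Case `C* = f`.  … If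
`dim Θ ≥ 2` … unpins an `f`-slot.  So `Θ = kθ`, `P_{p,f} = θ ⊗ α(ε_Z)`"; CARVER-NOTES-eng1-g42 T92).  The input is the output of
`WeightedCentreRZFirstOrder` (`∂_{θ_γ} ḡ = 0`, coefficientwise); the pin condition is the class-linear `(P)_S` of
`WeightedCentreClassLinearPin` (`InvariantDirection.ClassPinned`).  Contents (all OURS, toy-model bookkeeping):

* `RZUnpin.pderiv_killLight`, `RZUnpin.dirDeriv_killLight` — derivations along heavy slots commute with killing the light variables
  (the pins live on the faces `killLight`);
* `RZUnpin.dirDeriv_weightedHomogeneousComponent_zero_eq_zero` — the bridge from the coefficientwise conclusion of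
  `RZFirstOrder.coeff_sum_leading_mul_pderiv_eq_zero` to `∂_θ Ḡ = 0`;
* `RZUnpin.not_classPinned_of_dirDeriv_eq_zero` — CASE `C* =` AN `I`-CLASS: in characteristic `p`, a class `S` of weight `u` with
  `p·u < μ < (p+1)·u`, `F` weighted homogeneous of weight `μ` in variables of weight `≥ u`, and a non-zero `θ ∈ k^S` with `∂_θ F = 0`
  ⇒ `(P)_S` fails (move `θ` to a coordinate slot by a class-linear substitution; `∂ = 0` makes its exponents multiples of `p`
  (`InvariantDirection.dvd_of_pderiv_eq_zero`), and the weight window leaves no room for a positive multiple of `p`);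
* `RZUnpin.exists_rank_one_of_forall_dirDeriv_eq_zero` — CASE `C* = f`, `dim Θ ≤ 1` PACKAGED: for the class of weight `μ/p` under
  `(P)_S` (and `p`-th roots in `k`), a family of blocks `P^{lead}_j` supported on `S` all of whose coefficient columns `θ_γ` kill `F`
  is a tensor `P^{lead}_j = θ_j · α` (`InvariantDirection.ClassPinned.exists_eq_smul_of_dirDeriv_eq_zero`).

References: derivations and the Frobenius in characteristic `p` [Lang2002, Ch. IV §1, Ch. V §6]; linear changes of coordinates
[Lang2002, Ch. XIII §4]; the weighted frame [AbramovichTemkinWlodarczyk2024, §5.1 (p. 1575)].  VALUE: bookkeeping for a toy model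
(AI-written Lean; AI review is weaker than expert review); NOT a statement about the invariant of [AbramovichTemkinWlodarczyk2024],
NOT progress on the summit.
-/

namespace Literature.AlgebraicGeometry.Resolution.WeightedBlowup

namespace RZUnpin

open MvPolynomial

variable {ι : Type*} [Fintype ι] [DecidableEq ι] {L : Type*} [Field L]

/-! ## Derivations along heavy slots commute with `killLight` -/

omit [Fintype ι] in
/-- `∂_j ∘ killLight H = killLight H ∘ ∂_j` for a heavy slot `j` (ours, bookkeeping). [cite: AbramovichTemkinWlodarczyk2024, §5.1 (p. 1575)] -/
theorem pderiv_killLight (H : ι → Prop) [DecidablePred H] {j : ι} (hj : H j) (F : MvPolynomial ι L) :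
    pderiv j (killLight H F) = killLight H (pderiv j F) := by
  ext t
  rw [coeff_pderiv_eq, coeff_killLight, coeff_killLight, coeff_pderiv_eq]
  have hiff : IsHeavy H (t + Finsupp.single j 1) ↔ IsHeavy H t := by
    constructor
    · exact fun h => IsHeavy.mono H h le_self_add
    · intro h i hi
      rcases Finset.mem_union.mp (Finsupp.support_add hi) with h1 | h1
      · exact h i h1
      · rw [(Finsupp.mem_support_single _ _ _).mp h1 |>.1]
        exact hj
  by_cases ht : IsHeavy H t
  · rw [if_pos ht, if_pos (hiff.mpr ht)]
  · rw [if_neg ht, if_neg fun h => ht (hiff.mp h), mul_zero]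

/-- `∂_θ ∘ killLight H = killLight H ∘ ∂_θ` for `θ` supported on heavy slots (ours, bookkeeping).
[cite: AbramovichTemkinWlodarczyk2024, §5.1 (p. 1575)] -/
theorem dirDeriv_killLight (H : ι → Prop) [DecidablePred H] (θ : ι → L) (hθ : ∀ j, ¬ H j → θ j = 0)
    (F : MvPolynomial ι L) :
    InvariantDirection.dirDeriv θ (killLight H F) = killLight H (InvariantDirection.dirDeriv θ F) := by
  rw [InvariantDirection.dirDeriv, InvariantDirection.dirDeriv, map_sum]
  refine Finset.sum_congr rfl fun j _ => ?_
  by_cases hj : H j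
  · rw [map_mul, MvPolynomial.algHom_C, MvPolynomial.algebraMap_eq, pderiv_killLight H hj]
  · rw [hθ j hj, C_0, zero_mul, zero_mul, map_zero]

/-! ## From coefficients to `∂_θ Ḡ = 0` -/

omit [Fintype ι] in
/-- (ours, bookkeeping) A monomial of `∂_j Ḡ`, `Ḡ` the `zw`-weight-`0` component (`ℕ`-valued weights), only involves weight-`0` slots.
[cite: Lang2002, Ch. IV §1] -/
theorem coeff_pderiv_weightedHomogeneousComponent_zero (zw : ι → ℕ) (G : MvPolynomial ι L) (j : ι) {m : ι →₀ ℕ}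
    (hm : ∃ i ∈ m.support, zw i ≠ 0) : coeff m (pderiv j (weightedHomogeneousComponent zw 0 G)) = 0 := by
  by_contra hb
  obtain ⟨i, hi, hzi⟩ := hm
  have hc := hb
  rw [coeff_pderiv_eq] at hc
  have hb' : coeff (m + Finsupp.single j 1) (weightedHomogeneousComponent zw 0 G) ≠ 0 := fun h0 => hc (by rw [h0, mul_zero])
  have hw : Finsupp.weight zw (m + Finsupp.single j 1) = 0 := weightedHomogeneousComponent_isWeightedHomogeneous 0 G hb'
  rw [Finsupp.weight_apply, Finsupp.sum] at hw
  have hi' : i ∈ (m + Finsupp.single j 1).support := Finsupp.support_mono le_self_add hi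
  have h0 := (Finset.sum_eq_zero_iff_of_nonneg fun i _ => Nat.zero_le _).mp hw i hi'
  rw [smul_eq_mul, mul_eq_zero] at h0
  exact h0.elim (Finsupp.mem_support_iff.mp hi') hzi

/-- (ours, bookkeeping) **Bridge**: if `Σ_j θ_j · [x^m] ∂_j Ḡ = 0` for every `m` on the weight-`0` slots (the conclusion of
`RZFirstOrder.coeff_sum_leading_mul_pderiv_eq_zero`), then `∂_θ Ḡ = 0`. [cite: Lang2002, Ch. IV §1] -/
theorem dirDeriv_weightedHomogeneousComponent_zero_eq_zero (zw : ι → ℕ) (θ : ι → L) (G : MvPolynomial ι L)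
    (h : ∀ m : ι →₀ ℕ, (∀ i ∈ m.support, zw i = 0) →
      ∑ j, θ j * coeff m (pderiv j (weightedHomogeneousComponent zw 0 G)) = 0) :
    InvariantDirection.dirDeriv θ (weightedHomogeneousComponent zw 0 G) = 0 := by
  ext m
  rw [InvariantDirection.dirDeriv, coeff_sum, coeff_zero]
  simp_rw [coeff_C_mul]
  by_cases hm : ∀ i ∈ m.support, zw i = 0
  · exact h m hm
  · push Not at hm
    exact Finset.sum_eq_zero fun j _ => by
      rw [coeff_pderiv_weightedHomogeneousComponent_zero zw G j hm, mul_zero]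

/-! ## Case `C* =` an `I`-class: a derivation direction in the window `p·u < μ < (p+1)·u` unpins the class -/

/-- **THEOREM RZ, case `C* =` an `I`-class** (ours; RE-DERIVATION-eng1-g41 §3.7.4).  In characteristic `p`: `F` weighted homogeneous of
weight `μ` (positive rational weights) in variables of weight `≥ u`, the class `S` of weight `u` with `p·u < μ < (p+1)·u`, and a non-zero
vector `θ` supported in `S` with `∂_θ F = 0`.  Then the class-linear pin condition `(P)_S` FAILS at every slot of `S`.
PROOF: move `θ` to the coordinate slot `i₀` by an invertible class-linear `A` (`exists_classLinear_col_eq`); `F∘A` is again of weight `μ`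
in variables of weight `≥ u`, and `∂_{i₀}(F∘A) = (∂_θ F)∘A = 0` (`pderiv_linSubst`), so every exponent of `X_{i₀}` in `F∘A` is a multiple of
`p` (`dvd_of_pderiv_eq_zero`); a monomial of weight `μ` containing `X_{i₀}^{p}` weighs `p·u` (if pure) or `≥ (p+1)·u` — neither is `μ`.
So `X_{i₀} ∉ vars (F∘A)`, against `(P)_S`. [cite: Lang2002, Ch. V §6, Ch. XIII §4; AbramovichTemkinWlodarczyk2024, §5.1 (p. 1575)] -/
theorem not_classPinned_of_dirDeriv_eq_zero (p : ℕ) [Fact p.Prime] [CharP L p] {w : ι → ℚ} (hw : ∀ j, 0 < w j)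
    {μ u : ℚ} (hpu : (p : ℚ) * u < μ) (hμ : μ < (p + 1 : ℚ) * u) {F : MvPolynomial ι L}
    (hF : IsWeightedHomogeneous w F μ) (hFu : ∀ k ∈ F.vars, u ≤ w k) {S : Finset ι} (hS : ∀ i ∈ S, w i = u)
    {θ : ι → L} (hθ0 : θ ≠ 0) (hθS : ∀ j, j ∉ S → θ j = 0) (hD : InvariantDirection.dirDeriv θ F = 0)
    {i₀ : ι} (hi₀ : i₀ ∈ S) : ¬ InvariantDirection.ClassPinned S F i₀ := by
  intro hPin
  obtain ⟨A, A', hA, hA', hcl, hcol⟩ := InvariantDirection.exists_classLinear_col_eq θ hθ0 hθS hi₀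
  have hinj := InvariantDirection.linSubst_injective_of_mul_eq_one A A' hA
  have hu : 0 < u := by rw [← hS i₀ hi₀]; exact hw i₀
  have hmem : i₀ ∈ (InvariantDirection.linSubst (fun j k => A j k) F).vars := hPin A A' hA hA' hcl
  have hD' : pderiv i₀ (InvariantDirection.linSubst (fun j k => A j k) F) = 0 := by
    rw [InvariantDirection.pderiv_linSubst, show (fun j => A j i₀) = θ from funext hcol, hD, map_zero]
  have hwS : ∀ j ∈ S, ∀ k ∈ S, w j = w k := fun j hj k hk => (hS j hj).trans (hS k hk).symm
  have hF' : IsWeightedHomogeneous w (InvariantDirection.linSubst (fun j k => A j k) F) μ :=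
    hcl.isWeightedHomogeneous_linSubst hwS hF
  have hvars : ∀ k ∈ (InvariantDirection.linSubst (fun j k => A j k) F).vars, u ≤ w k := by
    intro k hk
    by_cases hkS : k ∈ S
    · exact (hS k hkS).ge
    · have hcolk : (fun j => A j k) = Pi.single k 1 := by
        funext j
        rw [hcl j k (Or.inr hkS), Matrix.one_apply, Pi.single_apply]
      have h := (InvariantDirection.mem_vars_linSubst_iff (fun j k => A j k) hinj F k).mp hk
      rw [hcolk, InvariantDirection.isInvariantDir_single_iff F k (one_ne_zero' L), not_not] at h
      exact hFu k h
  obtain ⟨m, hm, hi₀m⟩ := (mem_vars_iff_mem_support i₀).mp hmem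
  have hdvd : p ∣ m i₀ := InvariantDirection.dvd_of_pderiv_eq_zero p hD' hm
  have hmi₀ : p ≤ m i₀ := Nat.le_of_dvd (Nat.pos_of_ne_zero (Finsupp.mem_support_iff.mp hi₀m)) hdvd
  have hwm : (Finsupp.weight w m : ℚ) = μ := hF' (mem_support_iff.mp hm)
  have hvars_m : ∀ k ∈ m.support, u ≤ w k := fun k hk =>
    hvars k ((mem_vars_iff_mem_support k).mpr ⟨m, hm, hk⟩)
  rw [Finsupp.weight_apply, Finsupp.sum] at hwm
  by_cases hsingle : m.support = {i₀}
  · -- the pure power `X_{i₀}^{m i₀}` with `p ∣ m i₀`, `m i₀ ≥ p`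
    rw [hsingle, Finset.sum_singleton, hS i₀ hi₀, nsmul_eq_mul] at hwm
    rcases hmi₀.eq_or_lt with h | h
    · rw [← h] at hwm
      exact absurd hwm hpu.ne
    · obtain ⟨c, hc⟩ := hdvd
      have hc2 : 2 ≤ c := by
        by_contra hlt
        push Not at hlt
        interval_cases c <;> omega
      have hp1 : 1 ≤ p := (Fact.out : p.Prime).one_lt.le
      have hge : p + 1 ≤ m i₀ := by
        calc p + 1 ≤ p * 2 := by omega
          _ ≤ p * c := Nat.mul_le_mul_left p hc2
          _ = m i₀ := hc.symm
      have hge' : (p + 1 : ℚ) ≤ m i₀ := by exact_mod_cast hge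
      have := mul_le_mul_of_nonneg_right hge' hu.le
      linarith
  · -- another slot `k ≠ i₀` occurs: weight `≥ p·u + u`
    obtain ⟨k, hk, hki₀⟩ : ∃ k ∈ m.support, k ≠ i₀ := by
      by_contra hnone
      push Not at hnone
      exact hsingle (Finset.eq_singleton_iff_unique_mem.mpr ⟨hi₀m, hnone⟩)
    have hsub : ({i₀, k} : Finset ι) ⊆ m.support := by
      intro x hx
      rw [Finset.mem_insert, Finset.mem_singleton] at hx
      rcases hx with rfl | rfl
      exacts [hi₀m, hk]
    have h1 := Finset.sum_le_sum_of_subset_of_nonneg hsub (f := fun x => m x • w x)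
      (fun x _ _ => nsmul_nonneg (hw x).le _)
    rw [Finset.sum_pair hki₀.symm, hwm, hS i₀ hi₀, nsmul_eq_mul, nsmul_eq_mul] at h1
    have h2 : (p : ℚ) * u ≤ (m i₀ : ℚ) * u := mul_le_mul_of_nonneg_right (by exact_mod_cast hmi₀) hu.le
    have hmk : (1 : ℚ) ≤ m k := by exact_mod_cast Nat.one_le_iff_ne_zero.mpr (Finsupp.mem_support_iff.mp hk)
    have hwk : u ≤ w k := hvars_m k hk
    have h3 : u ≤ (m k : ℚ) * w k := by nlinarith [hw k]
    linarith

/-! ## Case `C* = f`: under `(P)_S` the derivation directions span at most a line — the blocks are a tensor `θ ⊗ α` -/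

/-- **THEOREM RZ, case `C* = f`, `Θ = kθ` and `P_{p,f}^{lead} = θ ⊗ α`** (ours; RE-DERIVATION-eng1-g41 §3.7.4).  In characteristic `p`
with `p`-th roots in `L`: `F` weighted homogeneous of weight `μ` (positive weights), the class `S` of weight `μ/p` pinned (`(P)_S` at some
`i₀ ∈ S`), and blocks `P^{lead}_j` (`j ∈ S`; zero off `S`) all of whose coefficient columns `θ_γ = ([x^γ] P^{lead}_j)_j` satisfy
`∂_{θ_γ} F = 0`.  Then there are ONE vector `θ` supported in `S` with `∂_θ F = 0` and ONE polynomial `α` with `P^{lead}_j = θ_j · α`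
for all `j` (`InvariantDirection.ClassPinned.exists_eq_smul_of_dirDeriv_eq_zero`: two independent directions would unpin the class).
[cite: Lang2002, Ch. V §6, Ch. XIII §4; AbramovichTemkinWlodarczyk2024, §5.1 (p. 1575)] -/
theorem exists_rank_one_of_forall_dirDeriv_eq_zero (p : ℕ) [Fact p.Prime] [CharP L p]
    (hperf : ∀ x : L, ∃ y : L, y ^ p = x) {w : ι → ℚ} (hw : ∀ j, 0 < w j) {μ : ℚ} {F : MvPolynomial ι L}
    (hF : IsWeightedHomogeneous w F μ) {S : Finset ι} (hS : ∀ i ∈ S, (p : ℚ) * w i = μ) {i₀ : ι} (hi₀ : i₀ ∈ S)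
    (hPin : InvariantDirection.ClassPinned S F i₀) (Plead : ι → MvPolynomial ι L) (hPS : ∀ j, j ∉ S → Plead j = 0)
    (hD : ∀ γ : ι →₀ ℕ, InvariantDirection.dirDeriv (fun j => coeff γ (Plead j)) F = 0) :
    ∃ (θ : ι → L) (α : MvPolynomial ι L), (∀ j, j ∉ S → θ j = 0) ∧ InvariantDirection.dirDeriv θ F = 0 ∧
      ∀ j, Plead j = θ j • α := by
  classical
  by_cases h0 : Plead = 0
  · refine ⟨0, 0, fun _ _ => rfl, ?_, fun j => ?_⟩
    · simp [InvariantDirection.dirDeriv]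
    · rw [h0, Pi.zero_apply, Pi.zero_apply, zero_smul]
  obtain ⟨j₀, hj₀⟩ := Function.ne_iff.mp h0
  obtain ⟨γ₀, hγ₀⟩ := MvPolynomial.ne_zero_iff.mp hj₀
  -- θ := the `γ₀`-column; every column is a multiple of it
  have hθS : ∀ γ : ι →₀ ℕ, ∀ j, j ∉ S → (fun j => coeff γ (Plead j)) j = 0 := fun γ j hj => by
    simp only [hPS j hj, coeff_zero]
  have hθ0 : (fun j => coeff γ₀ (Plead j)) ≠ 0 := fun h => hγ₀ (congrFun h j₀)
  have hdep : ∀ γ : ι →₀ ℕ, ∃ c : L, (fun j => coeff γ (Plead j)) = c • (fun j => coeff γ₀ (Plead j)) := fun γ =>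
    hPin.exists_eq_smul_of_dirDeriv_eq_zero p hperf hw hF hS hi₀ (hθS γ₀) (hθS γ) hθ0 (hD γ₀) (hD γ)
  choose c hc using hdep
  let T : Finset (ι →₀ ℕ) := Finset.univ.biUnion fun j => (Plead j).support
  refine ⟨fun j => coeff γ₀ (Plead j), ∑ γ ∈ T, monomial γ (c γ), hθS γ₀, hD γ₀, fun j => ?_⟩
  have hcj : ∀ γ, coeff γ (Plead j) = c γ * coeff γ₀ (Plead j) := fun γ => by
    simpa only [Pi.smul_apply, smul_eq_mul] using congrFun (hc γ) j
  rw [Finset.smul_sum]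
  calc Plead j = ∑ γ ∈ T, monomial γ (coeff γ (Plead j)) := by
        conv_lhs => rw [(Plead j).as_sum]
        exact Finset.sum_subset (Finset.subset_biUnion_of_mem (fun j => (Plead j).support) (Finset.mem_univ j))
          fun γ _ hγ => by rw [notMem_support_iff.mp hγ, monomial_zero]
    _ = ∑ γ ∈ T, coeff γ₀ (Plead j) • monomial γ (c γ) :=
        Finset.sum_congr rfl fun γ _ => by rw [hcj γ, smul_monomial, smul_eq_mul, mul_comm]

end RZUnpin

end Literature.AlgebraicGeometry.Resolution.WeightedBlowup
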